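import Mathlib
import HarnessLib

/-!
# Elements of the maximal real subfield of a CM field with prescribed signs at the infinite places

Topic `NumberTheory/NumberFields`; theorems only (no definition, no named fact, no instance).

Let `L` be a CM field (`NumberField.IsCMField L`) with complex conjugation `σ = IsCMField.complexConj L`.
A `σ`-fixed element `a` (i.e. `a ∈ L⁺ = maximalRealSubfield L`) is real at every complex embedding
`τ : L →+* ℂ`, with the same value at `τ` and `conj ∘ τ`, so its sign is a function on the infinite places of
`L`. This file proves that EVERY sign pattern occurs:

* `exists_neg_at_pos_off` — for each complex embedding `ι₁` there is `a ∈ L⁺` negative at `ι₁` and positive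
  at every embedding off the place of `ι₁` (`a = 1 - x·σx` for a Dirichlet unit `x` with `|x|_w < 1` at all
  places `w ≠ w₁`, hence `|x|_{w₁} > 1` by the product formula `∑ mult_w log |x|_w = 0`);
* `exists_neg_exactly_at` — the same phrased with the infinite place `w`;
* `exists_isReal_signs` — for every `P : InfinitePlace L → Bool` an `a ∈ L⁺`, non-zero real at every `τ`,
  positive exactly where `P` holds (products of the above).

This is weak approximation at the archimedean places for `L⁺ ⊂ L` in the form needed for signature
bookkeeping of hermitian forms over `L/L⁺` (Landherr's theorem in rank `n`,
`QuadraticForms/LandherrHermitianRankN.lean`): realising a prescribed signature change at one complex place.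

Provenance: `pub-hodgecm` reproduction of the arithmetic inputs of Deligne's "Hodge cycles on abelian
varieties" §4–5 (package files `Proofs/Landherr.lean` :47–95 and `Proofs/SignPattern.lean`), ported to Mathlib
vocabulary (`IsCMField.complexConj`).

## References

* J. Neukirch, *Algebraic Number Theory*, Grundlehren 322 (1999), Ch. I §7 (Dirichlet's unit theorem)
  — Mathlib `NumberField.Units.dirichletUnitTheorem.exists_unit`.
* W. Landherr, Abh. Math. Sem. Univ. Hamburg 11 (1936) 245–248 [Landherr1936HermitianForms] (consumer).
-/

noncomputable section

open NumberField NumberField.InfinitePlace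
open scoped ComplexConjugate

namespace Literature.NumberTheory.NumberFields

variable (L : Type) [Field L] [NumberField L] [IsCMField L]

/-- `τ (x · σ x) = ‖τ x‖²` at every complex embedding `τ` of a CM field (local copy of
`QuadraticForms.Landherr.embedding_mul_complexConj`, to keep this file's imports to Mathlib). [folklore] -/
theorem embedding_mul_complexConj (τ : L →+* ℂ) (x : L) :
    τ (x * IsCMField.complexConj L x) = ((‖τ x‖ ^ 2 : ℝ) : ℂ) := by
  rw [map_mul, IsCMField.complexEmbedding_complexConj, Complex.mul_conj, Complex.normSq_eq_norm_sq]

/-- **One negative place.** A CM field `L` with complex conjugation `σ` contains a `σ`-fixed element (an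
element of `L⁺`) which is a negative real number at the complex embedding `ι₁` and a positive real number at
every complex embedding off the infinite place of `ι₁`: `a = 1 - N(x)` for a unit `x` that is large at the place
of `ι₁` and small elsewhere (Dirichlet's unit theorem, `NumberField.Units.dirichletUnitTheorem.exists_unit`).
[folklore] -/
theorem exists_neg_at_pos_off (ι₁ : L →+* ℂ) :
    ∃ a : L, IsCMField.complexConj L a = a ∧ (∃ r : ℝ, ι₁ a = r ∧ r < 0) ∧
      ∀ τ : L →+* ℂ, InfinitePlace.mk τ ≠ InfinitePlace.mk ι₁ → ∃ s : ℝ, τ a = s ∧ 0 < s := by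
  by_cases hone : ∀ τ : L →+* ℂ, InfinitePlace.mk τ = InfinitePlace.mk ι₁
  · exact ⟨-1, by simp, ⟨-1, by simp, by norm_num⟩, fun τ hτ => (hτ (hone τ)).elim⟩
  push Not at hone
  obtain ⟨τ₀, hτ₀⟩ := hone
  set w₁ : InfinitePlace L := InfinitePlace.mk ι₁ with hw₁
  obtain ⟨u, hu⟩ := NumberField.Units.dirichletUnitTheorem.exists_unit L w₁
  set x : L := ((u : 𝓞 L) : L) with hx
  have hlt : ∀ w : InfinitePlace L, w ≠ w₁ → w x < 1 := fun w hw =>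
    (Real.log_neg_iff (Units.pos_at_place u w)).mp (hu w hw)
  have hgt : 1 < w₁ x := by
    classical
    have h := Units.sum_mult_mul_log u
    rw [Fintype.sum_eq_add_sum_subtype_ne _ w₁] at h
    have hne : Nonempty {w : InfinitePlace L // w ≠ w₁} := ⟨⟨InfinitePlace.mk τ₀, hτ₀⟩⟩
    have hneg : ∑ w : {w : InfinitePlace L // w ≠ w₁},
        ((w : InfinitePlace L).mult : ℝ) * Real.log ((w : InfinitePlace L) x) < 0 := by
      calc ∑ w : {w : InfinitePlace L // w ≠ w₁}, ((w : InfinitePlace L).mult : ℝ) * Real.log ((w : InfinitePlace L) x)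
          < ∑ _w : {w : InfinitePlace L // w ≠ w₁}, (0 : ℝ) := by
            apply Finset.sum_lt_sum_of_nonempty Finset.univ_nonempty
            intro w _
            exact mul_neg_of_pos_of_neg (Nat.cast_pos.mpr mult_pos) (hu w.1 w.2)
        _ = 0 := by simp
    have hpos : 0 < (w₁.mult : ℝ) * Real.log (w₁ x) := by linarith
    have hlog : 0 < Real.log (w₁ x) := by
      rcases mul_pos_iff.mp hpos with ⟨_, h2⟩ | ⟨h1, _⟩
      · exact h2
      · exact absurd h1 (not_lt.mpr (Nat.cast_nonneg _))
    exact (Real.log_pos_iff (Units.pos_at_place u w₁).le).mp hlog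
  refine ⟨1 - x * IsCMField.complexConj L x, ?_, ?_, ?_⟩
  · simp [map_sub, map_mul, IsCMField.complexConj_apply_apply, mul_comm]
  · refine ⟨1 - ‖ι₁ x‖ ^ 2, ?_, ?_⟩
    · rw [map_sub, map_one, embedding_mul_complexConj]; push_cast; ring
    · have : w₁ x = ‖ι₁ x‖ := by rw [hw₁]; rfl
      rw [this] at hgt
      nlinarith [norm_nonneg (ι₁ x)]
  · intro τ hτ
    refine ⟨1 - ‖τ x‖ ^ 2, ?_, ?_⟩
    · rw [map_sub, map_one, embedding_mul_complexConj]; push_cast; ring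
    · have h1 := hlt (InfinitePlace.mk τ) hτ
      have : (InfinitePlace.mk τ) x = ‖τ x‖ := rfl
      rw [this] at h1
      nlinarith [norm_nonneg (τ x)]

variable {L} in
/-- A `σ`-fixed element of a CM field takes the same (real) value at conjugate complex embeddings. [folklore] -/
theorem conjugate_apply_of_complexConj_eq {a : L} (ha : IsCMField.complexConj L a = a) (τ : L →+* ℂ) :
    ComplexEmbedding.conjugate τ a = τ a := by
  rw [ComplexEmbedding.conjugate_coe_eq, ← IsCMField.complexEmbedding_complexConj L, ha]

/-- One place: an element of `L⁺`, real and nonzero at every complex embedding, NEGATIVE exactly at the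
embeddings over the infinite place `w`. [folklore] -/
theorem exists_neg_exactly_at (w : InfinitePlace L) :
    ∃ b : L, IsCMField.complexConj L b = b ∧
      ∀ τ : L →+* ℂ, ∃ r : ℝ, τ b = r ∧ r ≠ 0 ∧ (r < 0 ↔ InfinitePlace.mk τ = w) := by
  obtain ⟨b, hb, ⟨r₀, hr₀, hr₀neg⟩, hpos⟩ := exists_neg_at_pos_off L w.embedding
  refine ⟨b, hb, fun τ => ?_⟩
  by_cases hτ : InfinitePlace.mk τ = w
  · have hτ' : InfinitePlace.mk τ = InfinitePlace.mk w.embedding := by rw [mk_embedding]; exact hτ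
    rcases mk_eq_iff.mp hτ' with h | h
    · exact ⟨r₀, by rw [h]; exact hr₀, hr₀neg.ne, ⟨fun _ => hτ, fun _ => hr₀neg⟩⟩
    · refine ⟨r₀, ?_, hr₀neg.ne, ⟨fun _ => hτ, fun _ => hr₀neg⟩⟩
      rw [← conjugate_apply_of_complexConj_eq hb τ, h, hr₀]
  · obtain ⟨s, hs, hspos⟩ := hpos τ (by rwa [mk_embedding])
    exact ⟨s, hs, hspos.ne', ⟨fun h => absurd hspos (not_lt.mpr h.le), fun h => absurd h hτ⟩⟩

/-- **Prescribed signs at the real places** (weak approximation at infinity for `L₀ ⊂ L`): for every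
`P : InfinitePlace L → Bool` there is `a ∈ L⁺` (`σ a = a`) with `τ a` real, nonzero, and positive iff `P (mk τ)`.
Proof: multiply the one-place elements of `exists_neg_exactly_at` over the places where `P` is false.
[folklore] -/
theorem exists_isReal_signs (P : InfinitePlace L → Bool) :
    ∃ a : L, IsCMField.complexConj L a = a ∧
      ∀ τ : L →+* ℂ, ∃ r : ℝ, τ a = r ∧ r ≠ 0 ∧ (0 < r ↔ P (InfinitePlace.mk τ) = true) := by
  classical
  suffices h : ∀ N : Finset (InfinitePlace L), ∃ a : L, IsCMField.complexConj L a = a ∧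
      ∀ τ : L →+* ℂ, ∃ r : ℝ, τ a = r ∧ r ≠ 0 ∧ (r < 0 ↔ InfinitePlace.mk τ ∈ N) by
    obtain ⟨a, ha, h⟩ := h (Finset.univ.filter fun w => P w = false)
    refine ⟨a, ha, fun τ => ?_⟩
    obtain ⟨r, hr, hr0, hiff⟩ := h τ
    refine ⟨r, hr, hr0, ?_⟩
    simp only [Finset.mem_filter, Finset.mem_univ, true_and] at hiff
    constructor
    · intro hpos
      by_contra hP
      have hneg := hiff.mpr (by simpa using hP)
      exact absurd hpos (not_lt.mpr hneg.le)
    · intro hP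
      rcases lt_trichotomy r 0 with hlt | heq | hgt
      · have := hiff.mp hlt; rw [hP] at this; exact absurd this (by decide)
      · exact absurd heq hr0
      · exact hgt
  intro N
  induction N using Finset.induction_on with
  | empty => exact ⟨1, by simp, fun τ => ⟨1, by simp, one_ne_zero, by simp⟩⟩
  | @insert w N hw ih =>
    obtain ⟨a, ha, hA⟩ := ih
    obtain ⟨b, hb, hB⟩ := exists_neg_exactly_at L w
    refine ⟨b * a, by rw [map_mul, ha, hb], fun τ => ?_⟩
    obtain ⟨r, hr, hr0, hriff⟩ := hA τ
    obtain ⟨s, hs, hs0, hsiff⟩ := hB τ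
    refine ⟨s * r, by rw [map_mul, hr, hs]; push_cast; ring, mul_ne_zero hs0 hr0, ?_⟩
    rw [Finset.mem_insert]
    rcases lt_or_gt_of_ne hs0 with hsn | hsp <;> rcases lt_or_gt_of_ne hr0 with hrn | hrp
    · exact absurd ((hsiff.mp hsn) ▸ hriff.mp hrn) hw
    · exact ⟨fun _ => Or.inl (hsiff.mp hsn), fun _ => mul_neg_of_neg_of_pos hsn hrp⟩
    · exact ⟨fun _ => Or.inr (hriff.mp hrn), fun _ => mul_neg_of_pos_of_neg hsp hrn⟩
    · constructor
      · intro h; exact absurd h (not_lt.mpr (mul_pos hsp hrp).le)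
      · rintro (h | h)
        · exact absurd (hsiff.mpr h) (not_lt.mpr hsp.le)
        · exact absurd (hriff.mpr h) (not_lt.mpr hrp.le)

end Literature.NumberTheory.NumberFields

end
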